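import Mathlib.Analysis.Matrix.Spectrum
import Mathlib.Analysis.InnerProductSpace.PiL2
import Literature.ComputerArithmetic.Higham2002.Summation
import Summits.Ventures.YMGap.FlowData.MatrixFreeLevelCertificate
import HarnessLib

/-!
# Entrywise forward error of a chain of matrix–vector stages (the a-priori `|·|`-chain)

HONEST FRAMING: elementary rounding-error algebra over `ℝ` (finite sums, absolute values) plus a hand-over
to the tree's Weinstein ball and Frobenius deflation.  It is the bookkeeping step behind the «a-priori float
model» constants of the Y3 FLOW-DATA certificates (route O's residual radius `ρ_T`, error vector `err2` and
Frobenius mass `U` in `mf_routeO.py`; the same shape as the dense points' assembly radius `E_fro`): push a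
NONNEGATIVE vector through the entrywise absolute values `|F̃_s|` of the computed factors and multiply by a
product of per-stage constants.  Proved here: this bounds the true error, under two per-stage hypotheses —
(R) ROUNDING `|ŵ_s − F̃_s ŵ_{s−1}| ≤ γ_s |F̃_s||ŵ_{s−1}|` (recursive summation of `k` rounded products:
`γ_s = γ_k = ku/(1−ku)`, Higham (3.4)–(3.5); discharged from the standard model in §6 through the tree's
`Literature.ComputerArithmetic.Higham2002.recDot`) and (E) ENTRY MODEL `|F̃_s − F_s| ≤ η_s |F̃_s|`.  §2: the
invariant «`|ŵ − w| ≤ (c−1)a`, `|ŵ| ≤ g a`, `|w| ≤ e a`» (`a ≥ 0`) propagates with `a ↦ |F̃_s| a`,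
`c ↦ (1+γ_s)(1+η_s)c`, `g ↦ (1+γ_s)g`, `e ↦ (1+η_s)e`; from an exact start (`a = |v|`, `c = g = e = 1`) any
number of stages of any rectangular shapes compose, closed form `|ŵ_m − F_m⋯F_1 v| ≤ (∏(1+γ_s)(1+η_s) − 1)·
|F̃_m|⋯|F̃_1||v|` (two-stage instance `abs_sub_mulVec_mulVec_le`).  §3: the last step `r̂ = fl(ŵ − θv)`.
§4: `|r̂ − (Av − θv)| ≤ E` entrywise ⇒ `‖Av − θv‖ ≤ ‖r̂‖ + ‖E‖` = the hypothesis of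
`MatrixFreeLevel.exists_abs_eigenvalues₀_sub_le_of_norm_le` (a float residual plus the a-priori error norm IS
a rigorous Weinstein radius).  §5: the same bounds for the basis vectors give `Σ Aᵢₗ² ≤ Σ_l (‖ŵ⁽ˡ⁾‖ +
‖E⁽ˡ⁾‖)²`, the input `hU` of `FrobeniusDeflation.*` (self-isolation).  Which numbers a run feeds these
hypotheses (IEEE binary64 round-to-nearest kernels, term counts `k`, widths `η`) is its audit witness, not a
theorem; nothing here is a lattice, continuum or Clay statement.

Namespace `Summit.Ventures.YMGap.FlowData.MatvecChain`.

## References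
* [Higham2002ASNA] N. J. Higham, *Accuracy and Stability of Numerical Algorithms*, 2nd ed., SIAM 2002 —
  §3.1 (inner products, Lemma 3.1, (3.4)–(3.5)), §3.4 (Lemma 3.3: arithmetic of the `θ`/`γ` constants),
  §3.5 (matrix–vector and matrix–matrix products: `ŷ = (A + ΔA)x`, `|ΔA| ≤ γ_n |A|`).
* [HornJohnson2013] R. A. Horn, C. R. Johnson, *Matrix Analysis*, 2nd ed., CUP 2013 — Thm 6.3.14 (Weinstein),
  §5.6 (the Frobenius norm).
-/

noncomputable section

open Matrix WithLp Finset

namespace Summit.Ventures.YMGap.FlowData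

namespace MatvecChain

/-! ### §1 Entrywise calculus of `|M| = M.map abs` -/

section Entrywise

variable {m n : Type*} [Fintype n]

/-- `|(M x)ᵢ| ≤ (|M| |x|)ᵢ`. [cite: Higham2002ASNA, §3.5] -/
theorem abs_mulVec_apply_le (M : Matrix m n ℝ) (x : n → ℝ) (i : m) :
    |(M *ᵥ x) i| ≤ (M.map abs *ᵥ fun j => |x j|) i := by
  simp only [Matrix.mulVec, dotProduct, Matrix.map_apply]
  refine (Finset.abs_sum_le_sum_abs _ _).trans (le_of_eq ?_)
  exact Finset.sum_congr rfl fun j _ => abs_mul _ _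

/-- `|M| x ≥ 0` for `x ≥ 0`. [folklore] -/
theorem map_abs_mulVec_nonneg (M : Matrix m n ℝ) {x : n → ℝ} (h : ∀ j, 0 ≤ x j) (i : m) :
    0 ≤ (M.map abs *ᵥ x) i := by
  simp only [Matrix.mulVec, dotProduct, Matrix.map_apply]
  exact Finset.sum_nonneg fun j _ => mul_nonneg (abs_nonneg _) (h j)

/-- `|M| x ≤ c · |M| a` entrywise when `x ≤ c · a` entrywise (monotonicity of `|M|`). [folklore] -/
theorem map_abs_mulVec_le_mul (M : Matrix m n ℝ) {x a : n → ℝ} {c : ℝ} (h : ∀ j, x j ≤ c * a j)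
    (i : m) : (M.map abs *ᵥ x) i ≤ c * (M.map abs *ᵥ a) i := by
  simp only [Matrix.mulVec, dotProduct, Matrix.map_apply, Finset.mul_sum]
  exact Finset.sum_le_sum fun j _ =>
    (mul_le_mul_of_nonneg_left (h j) (abs_nonneg _)).trans_eq (by ring)

omit [Fintype n] in
/-- Entry model ⇒ `|F| ≤ (1 + η)|F̃|` entrywise. [cite: Higham2002ASNA, §3.4 Lemma 3.3] -/
theorem abs_le_one_add_mul_abs_of_entry {F Fc : Matrix m n ℝ} {η : ℝ}
    (hentry : ∀ i j, |Fc i j - F i j| ≤ η * |Fc i j|) (i : m) (j : n) :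
    |F i j| ≤ (1 + η) * |Fc i j| := by
  have h := abs_sub_abs_le_abs_sub (F i j) (Fc i j); rw [abs_sub_comm] at h; linarith [hentry i j]

end Entrywise

/-! ### §2 One stage of the chain, and the start -/

section Stage

variable {m n : Type*} [Fintype n]

/-- **One stage, error.**  Exact factor `F`, computed factor `F̃ = Fc` with ENTRY MODEL
`|F̃ − F| ≤ η|F̃|`; exact input `w`, computed input `ŵ = wc`, computed output `ŵ' = wc'` with ROUNDING
`|ŵ' − F̃ŵ| ≤ γ |F̃||ŵ|`; invariant `|ŵ − w| ≤ (c−1)a`, `|ŵ| ≤ g a`, `|w| ≤ e a` (`a ≥ 0`, `g, e ≤ c`).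
Then `|ŵ' − F w| ≤ ((1+γ)(1+η)c − 1) · |F̃| a` entrywise.
[cite: Higham2002ASNA, §3.5; §3.4 Lemma 3.3] -/
theorem abs_sub_mulVec_le_of_stage {F Fc : Matrix m n ℝ} {w wc : n → ℝ} {wc' : m → ℝ} {a : n → ℝ}
    {γ η c g e : ℝ} (hγ : 0 ≤ γ) (hη : 0 ≤ η) (hc : 0 ≤ c) (hgc : g ≤ c) (hec : e ≤ c)
    (ha : ∀ j, 0 ≤ a j)
    (hround : ∀ i, |wc' i - (Fc *ᵥ wc) i| ≤ γ * (Fc.map abs *ᵥ fun j => |wc j|) i)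
    (hentry : ∀ i j, |Fc i j - F i j| ≤ η * |Fc i j|)
    (herr : ∀ j, |wc j - w j| ≤ (c - 1) * a j) (hhat : ∀ j, |wc j| ≤ g * a j)
    (hex : ∀ j, |w j| ≤ e * a j) (i : m) :
    |wc' i - (F *ᵥ w) i| ≤ ((1 + γ) * (1 + η) * c - 1) * (Fc.map abs *ᵥ a) i := by
  have hP : 0 ≤ (Fc.map abs *ᵥ a) i := map_abs_mulVec_nonneg Fc ha i
  have hsplit : wc' i - (F *ᵥ w) i =
      (wc' i - (Fc *ᵥ wc) i) + (Fc *ᵥ (wc - w)) i + ((Fc - F) *ᵥ w) i := by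
    rw [Matrix.mulVec_sub, Matrix.sub_mulVec, Pi.sub_apply, Pi.sub_apply]
    ring
  have h1 : |wc' i - (Fc *ᵥ wc) i| ≤ γ * g * (Fc.map abs *ᵥ a) i := by
    refine (hround i).trans ?_
    rw [mul_assoc]
    exact mul_le_mul_of_nonneg_left (map_abs_mulVec_le_mul Fc hhat i) hγ
  have h2 : |(Fc *ᵥ (wc - w)) i| ≤ (c - 1) * (Fc.map abs *ᵥ a) i :=
    (abs_mulVec_apply_le Fc (wc - w) i).trans
      (map_abs_mulVec_le_mul Fc (fun j => by simpa only [Pi.sub_apply] using herr j) i)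
  have h3 : |((Fc - F) *ᵥ w) i| ≤ η * e * (Fc.map abs *ᵥ a) i := by
    simp only [Matrix.mulVec, dotProduct, Matrix.map_apply, Matrix.sub_apply, Finset.mul_sum]
    refine (Finset.abs_sum_le_sum_abs _ _).trans (Finset.sum_le_sum fun j _ => ?_)
    rw [abs_mul]
    calc |Fc i j - F i j| * |w j| ≤ (η * |Fc i j|) * (e * a j) :=
          mul_le_mul (hentry i j) (hex j) (abs_nonneg _) (mul_nonneg hη (abs_nonneg _))
      _ = η * e * (|Fc i j| * a j) := by ring
  have hcoef : γ * g + (c - 1) + η * e ≤ (1 + γ) * (1 + η) * c - 1 := by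
    nlinarith [mul_nonneg hγ (sub_nonneg.2 hgc), mul_nonneg hη (sub_nonneg.2 hec),
      mul_nonneg (mul_nonneg hγ hη) hc]
  rw [hsplit]
  calc |wc' i - (Fc *ᵥ wc) i + (Fc *ᵥ (wc - w)) i + ((Fc - F) *ᵥ w) i|
      ≤ |wc' i - (Fc *ᵥ wc) i| + |(Fc *ᵥ (wc - w)) i| + |((Fc - F) *ᵥ w) i| :=
        (abs_add_le _ _).trans (add_le_add (abs_add_le _ _) le_rfl)
    _ ≤ γ * g * (Fc.map abs *ᵥ a) i + (c - 1) * (Fc.map abs *ᵥ a) i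
          + η * e * (Fc.map abs *ᵥ a) i := add_le_add (add_le_add h1 h2) h3
    _ = (γ * g + (c - 1) + η * e) * (Fc.map abs *ᵥ a) i := by ring
    _ ≤ ((1 + γ) * (1 + η) * c - 1) * (Fc.map abs *ᵥ a) i :=
        mul_le_mul_of_nonneg_right hcoef hP

/-- **One stage, size of the computed vector.** `|ŵ' − F̃ŵ| ≤ γ|F̃||ŵ|` and `|ŵ| ≤ g a` give
`|ŵ'| ≤ (1+γ) g · |F̃| a`. [cite: Higham2002ASNA, §3.5] -/
theorem abs_le_of_stage {Fc : Matrix m n ℝ} {wc : n → ℝ} {wc' : m → ℝ} {a : n → ℝ} {γ g : ℝ} (hγ : 0 ≤ γ)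
    (hround : ∀ i, |wc' i - (Fc *ᵥ wc) i| ≤ γ * (Fc.map abs *ᵥ fun j => |wc j|) i)
    (hhat : ∀ j, |wc j| ≤ g * a j) (i : m) :
    |wc' i| ≤ (1 + γ) * g * (Fc.map abs *ᵥ a) i := by
  have hQ : (Fc.map abs *ᵥ fun j => |wc j|) i ≤ g * (Fc.map abs *ᵥ a) i :=
    map_abs_mulVec_le_mul Fc hhat i
  have h0 : |wc' i| ≤ |wc' i - (Fc *ᵥ wc) i| + |(Fc *ᵥ wc) i| := by
    have := abs_add_le (wc' i - (Fc *ᵥ wc) i) ((Fc *ᵥ wc) i)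
    rwa [sub_add_cancel] at this
  calc |wc' i| ≤ γ * (Fc.map abs *ᵥ fun j => |wc j|) i + (Fc.map abs *ᵥ fun j => |wc j|) i :=
        h0.trans (add_le_add (hround i) (abs_mulVec_apply_le Fc wc i))
    _ = (1 + γ) * (Fc.map abs *ᵥ fun j => |wc j|) i := by ring
    _ ≤ (1 + γ) * (g * (Fc.map abs *ᵥ a) i) := mul_le_mul_of_nonneg_left hQ (by linarith)
    _ = (1 + γ) * g * (Fc.map abs *ᵥ a) i := by ring

/-- **One stage, size of the exact vector.** `|F̃ − F| ≤ η|F̃|` and `|w| ≤ e a` give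
`|F w| ≤ (1+η) e · |F̃| a`. [cite: Higham2002ASNA, §3.4 Lemma 3.3] -/
theorem abs_mulVec_le_of_stage {F Fc : Matrix m n ℝ} {w : n → ℝ} {a : n → ℝ} {η e : ℝ}
    (hη : 0 ≤ η) (hentry : ∀ i j, |Fc i j - F i j| ≤ η * |Fc i j|) (hex : ∀ j, |w j| ≤ e * a j)
    (i : m) : |(F *ᵥ w) i| ≤ (1 + η) * e * (Fc.map abs *ᵥ a) i := by
  simp only [Matrix.mulVec, dotProduct, Matrix.map_apply, Finset.mul_sum]
  refine (Finset.abs_sum_le_sum_abs _ _).trans (Finset.sum_le_sum fun j _ => ?_)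
  rw [abs_mul]
  calc |F i j| * |w j| ≤ ((1 + η) * |Fc i j|) * (e * a j) :=
        mul_le_mul (abs_le_one_add_mul_abs_of_entry hentry i j) (hex j) (abs_nonneg _)
          (mul_nonneg (by linarith) (abs_nonneg _))
    _ = (1 + η) * e * (|Fc i j| * a j) := by ring

/-- The updated constants keep the invariant's side conditions: `g ≤ c ⇒ (1+γ)g ≤ (1+γ)(1+η)c` (for
`η ≥ 0`, `c ≥ 0`, `1 + γ ≥ 0`). [folklore] -/
theorem one_add_mul_le_step {γ η c g : ℝ} (hγ : 0 ≤ γ) (hη : 0 ≤ η) (hc : 0 ≤ c) (hgc : g ≤ c) :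
    (1 + γ) * g ≤ (1 + γ) * (1 + η) * c := by
  nlinarith [mul_nonneg (add_nonneg zero_le_one hγ) (mul_nonneg hη hc),
    mul_le_mul_of_nonneg_left hgc (add_nonneg zero_le_one hγ)]

/-- Same for the exact-side constant: `e ≤ c ⇒ (1+η)e ≤ (1+γ)(1+η)c`. [folklore] -/
theorem one_add_mul_le_step' {γ η c e : ℝ} (hγ : 0 ≤ γ) (hη : 0 ≤ η) (hc : 0 ≤ c) (hec : e ≤ c) :
    (1 + η) * e ≤ (1 + γ) * (1 + η) * c := by
  nlinarith [mul_nonneg (add_nonneg zero_le_one hη) (mul_nonneg hγ hc),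
    mul_le_mul_of_nonneg_left hec (add_nonneg zero_le_one hη)]

omit [Fintype n] in
/-- **Start of the chain** (exact input `ŵ₀ = w₀ = v`): error invariant with `c = 1`, `a = |v|`. [folklore] -/
theorem chain_start_err (v : n → ℝ) (j : n) : |v j - v j| ≤ (1 - 1) * |v j| := by simp

omit [Fintype n] in
/-- Start of the chain: `|ŵ₀| ≤ 1 · |v|`. [folklore] -/
theorem chain_start_hat (v : n → ℝ) (j : n) : |v j| ≤ 1 * |v j| := by simp

end Stage

section TwoStage

variable {p m n : Type*} [Fintype m] [Fintype n]

/-- **Two-stage closed form** (the pattern for any number of stages of any shapes): exact input `v`,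
stages `(F₁, F̃₁, γ₁, η₁)` then `(F₂, F̃₂, γ₂, η₂)`, computed vectors `ŵ₁`, `ŵ₂` ⇒
`|ŵ₂ − F₂ F₁ v| ≤ ((1+γ₁)(1+η₁)(1+γ₂)(1+η₂) − 1) · |F̃₂| |F̃₁| |v|` entrywise.
[cite: Higham2002ASNA, §3.5; §3.4 Lemma 3.3] -/
theorem abs_sub_mulVec_mulVec_le {F₁ Fc₁ : Matrix m n ℝ} {F₂ Fc₂ : Matrix p m ℝ} {v : n → ℝ}
    {wc₁ : m → ℝ} {wc₂ : p → ℝ} {γ₁ η₁ γ₂ η₂ : ℝ} (hγ₁ : 0 ≤ γ₁) (hη₁ : 0 ≤ η₁) (hγ₂ : 0 ≤ γ₂) (hη₂ : 0 ≤ η₂)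
    (hround₁ : ∀ i, |wc₁ i - (Fc₁ *ᵥ v) i| ≤ γ₁ * (Fc₁.map abs *ᵥ fun j => |v j|) i)
    (hentry₁ : ∀ i j, |Fc₁ i j - F₁ i j| ≤ η₁ * |Fc₁ i j|)
    (hround₂ : ∀ i, |wc₂ i - (Fc₂ *ᵥ wc₁) i| ≤ γ₂ * (Fc₂.map abs *ᵥ fun j => |wc₁ j|) i)
    (hentry₂ : ∀ i j, |Fc₂ i j - F₂ i j| ≤ η₂ * |Fc₂ i j|) (i : p) :
    |wc₂ i - (F₂ *ᵥ (F₁ *ᵥ v)) i| ≤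
      ((1 + γ₁) * (1 + η₁) * (1 + γ₂) * (1 + η₂) - 1) *
        (Fc₂.map abs *ᵥ (Fc₁.map abs *ᵥ fun j => |v j|)) i := by
  have ha₀ : ∀ j, 0 ≤ |v j| := fun j => abs_nonneg _
  have e₁ : ∀ k, |wc₁ k - (F₁ *ᵥ v) k| ≤
      ((1 + γ₁) * (1 + η₁) * 1 - 1) * (Fc₁.map abs *ᵥ fun j => |v j|) k :=
    abs_sub_mulVec_le_of_stage hγ₁ hη₁ zero_le_one le_rfl le_rfl ha₀ hround₁ hentry₁
      (chain_start_err v) (chain_start_hat v) (chain_start_hat v)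
  have g₁ : ∀ k, |wc₁ k| ≤ (1 + γ₁) * 1 * (Fc₁.map abs *ᵥ fun j => |v j|) k :=
    abs_le_of_stage hγ₁ hround₁ (chain_start_hat v)
  have x₁ : ∀ k, |(F₁ *ᵥ v) k| ≤ (1 + η₁) * 1 * (Fc₁.map abs *ᵥ fun j => |v j|) k :=
    abs_mulVec_le_of_stage hη₁ hentry₁ (chain_start_hat v)
  have ha₁ : ∀ k, 0 ≤ (Fc₁.map abs *ᵥ fun j => |v j|) k := map_abs_mulVec_nonneg Fc₁ ha₀
  have hc₁ : 0 ≤ (1 + γ₁) * (1 + η₁) * 1 := by positivity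
  have e₂ := abs_sub_mulVec_le_of_stage (F := F₂) (wc' := wc₂) hγ₂ hη₂ hc₁
    (one_add_mul_le_step hγ₁ hη₁ zero_le_one le_rfl) (one_add_mul_le_step' hγ₁ hη₁ zero_le_one le_rfl)
    ha₁ hround₂ hentry₂ (fun k => by simpa only [mul_one] using e₁ k) g₁ x₁ i
  refine e₂.trans (le_of_eq ?_)
  ring

end TwoStage

/-! ### §3 The final residual step `r̂ = fl(ŵ − θ v)` -/

section Residual

variable {n : Type*}

/-- **Two roundings.** `r̂ᵢ = (ŵᵢ − θ vᵢ (1 + δ₁))(1 + δ₂)` with `|δ₁|, |δ₂| ≤ u` (one rounded product, one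
rounded subtraction) ⇒ `|r̂ᵢ − (ŵᵢ − θ vᵢ)| ≤ u|ŵᵢ| + (2u + u²)|θ||vᵢ|`.
[cite: Higham2002ASNA, §3.1 Lemma 3.1] -/
theorem abs_residual_round_le {wc v r δ₁ δ₂ : n → ℝ} {θ u : ℝ} (hu : 0 ≤ u) (hδ₁ : ∀ i, |δ₁ i| ≤ u)
    (hδ₂ : ∀ i, |δ₂ i| ≤ u) (hr : ∀ i, r i = (wc i - θ * v i * (1 + δ₁ i)) * (1 + δ₂ i)) (i : n) :
    |r i - (wc i - θ * v i)| ≤ u * |wc i| + (2 * u + u * u) * (|θ| * |v i|) := by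
  have hsplit : r i - (wc i - θ * v i) = δ₂ i * wc i - (θ * v i) * (δ₁ i + δ₂ i + δ₁ i * δ₂ i) := by
    rw [hr i]; ring
  have h1 : |δ₂ i * wc i| ≤ u * |wc i| := by
    rw [abs_mul]; exact mul_le_mul_of_nonneg_right (hδ₂ i) (abs_nonneg _)
  have h2 : |δ₁ i + δ₂ i + δ₁ i * δ₂ i| ≤ 2 * u + u * u := by
    refine (abs_add_le _ _).trans (add_le_add ((abs_add_le _ _).trans (by linarith [hδ₁ i, hδ₂ i])) ?_)
    rw [abs_mul]; exact mul_le_mul (hδ₁ i) (hδ₂ i) (abs_nonneg _) hu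
  have h3 : |θ * v i * (δ₁ i + δ₂ i + δ₁ i * δ₂ i)| ≤ (|θ| * |v i|) * (2 * u + u * u) := by
    rw [abs_mul, abs_mul]; exact mul_le_mul_of_nonneg_left h2 (by positivity)
  rw [hsplit]
  calc |δ₂ i * wc i - θ * v i * (δ₁ i + δ₂ i + δ₁ i * δ₂ i)|
      ≤ |δ₂ i * wc i| + |θ * v i * (δ₁ i + δ₂ i + δ₁ i * δ₂ i)| := abs_sub _ _
    _ ≤ u * |wc i| + (|θ| * |v i|) * (2 * u + u * u) := add_le_add h1 h3
    _ = u * |wc i| + (2 * u + u * u) * (|θ| * |v i|) := by ring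

/-- **Residual, entrywise.** A chain bound `|ŵ − A v| ≤ E` and a rounding bound `|r̂ − (ŵ − θv)| ≤ E'`
give `|r̂ − (A v − θ v)| ≤ E + E'` entrywise. [folklore] -/
theorem abs_residual_sub_le [Fintype n] {A : Matrix n n ℝ} {v wc r E E' : n → ℝ} {θ : ℝ}
    (hw : ∀ i, |wc i - (A *ᵥ v) i| ≤ E i) (hr : ∀ i, |r i - (wc i - θ * v i)| ≤ E' i) (i : n) :
    |r i - ((A *ᵥ v) i - θ * v i)| ≤ E i + E' i := by
  have hsplit : r i - ((A *ᵥ v) i - θ * v i) = (wc i - (A *ᵥ v) i) + (r i - (wc i - θ * v i)) := by ring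
  rw [hsplit]
  exact (abs_add_le _ _).trans (add_le_add (hw i) (hr i))

end Residual

/-! ### §4 Hand-over to the 2-norm and to Weinstein's ball -/

section Norm

variable {n : Type*} [Fintype n]

/-- Entrywise domination ⇒ Euclidean-norm domination: `|xᵢ| ≤ Eᵢ ⇒ ‖x‖ ≤ ‖E‖`. [folklore] -/
theorem norm_toLp_le_of_abs_le {x E : n → ℝ} (h : ∀ i, |x i| ≤ E i) :
    ‖(toLp 2 x : EuclideanSpace ℝ n)‖ ≤ ‖(toLp 2 E : EuclideanSpace ℝ n)‖ := by
  have hsq : ‖(toLp 2 x : EuclideanSpace ℝ n)‖ ^ 2 ≤ ‖(toLp 2 E : EuclideanSpace ℝ n)‖ ^ 2 := by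
    rw [MatrixFreeLevel.norm_sq_toLp_eq_sum, MatrixFreeLevel.norm_sq_toLp_eq_sum]
    refine Finset.sum_le_sum fun i _ => ?_
    calc x i ^ 2 = |x i| ^ 2 := (sq_abs _).symm
      _ ≤ E i ^ 2 := pow_le_pow_left₀ (abs_nonneg _) (h i) 2
  exact (pow_le_pow_iff_left₀ (norm_nonneg _) (norm_nonneg _) two_ne_zero).1 hsq

/-- A computed vector `r̂` with `|r̂ − a| ≤ E` entrywise bounds the exact one: `‖a‖ ≤ ‖r̂‖ + ‖E‖`.
[folklore] -/
theorem norm_toLp_le_add_of_abs_sub_le {a r E : n → ℝ} (h : ∀ i, |r i - a i| ≤ E i) :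
    ‖(toLp 2 a : EuclideanSpace ℝ n)‖ ≤
      ‖(toLp 2 r : EuclideanSpace ℝ n)‖ + ‖(toLp 2 E : EuclideanSpace ℝ n)‖ := by
  have h2 : (toLp 2 a : EuclideanSpace ℝ n) = toLp 2 r - toLp 2 (r - a) := by
    rw [← toLp_sub, sub_sub_cancel]
  have h3 : ‖(toLp 2 (r - a) : EuclideanSpace ℝ n)‖ ≤ ‖(toLp 2 E : EuclideanSpace ℝ n)‖ :=
    norm_toLp_le_of_abs_le fun i => by simpa only [Pi.sub_apply] using h i
  rw [h2]
  exact (norm_sub_le _ _).trans (add_le_add le_rfl h3)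

/-- **Residual norm from a computed residual and an entrywise error bound.**
`|r̂ᵢ − ((A x)ᵢ − μ xᵢ)| ≤ Eᵢ ⇒ ‖A x − μ x‖ ≤ ‖r̂‖ + ‖E‖`. [folklore] -/
theorem residual_norm_le_of_entrywise [DecidableEq n] (A : Matrix n n ℝ) (x : n → ℝ) (μ : ℝ) {r E : n → ℝ}
    (h : ∀ i, |r i - ((A *ᵥ x) i - μ * x i)| ≤ E i) :
    ‖toEuclideanLin A (toLp 2 x) - μ • toLp 2 x‖ ≤
      ‖(toLp 2 r : EuclideanSpace ℝ n)‖ + ‖(toLp 2 E : EuclideanSpace ℝ n)‖ := by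
  have h1 : toEuclideanLin A (toLp 2 x) - μ • toLp 2 x = toLp 2 (A *ᵥ x - μ • x) := by
    rw [toLp_sub, toLp_smul]
    rfl
  rw [h1]
  exact norm_toLp_le_add_of_abs_sub_le fun i => by
    simpa only [Pi.sub_apply, Pi.smul_apply, smul_eq_mul] using h i

/-- **Rigorous residual radius ⇒ Weinstein ball.** With `x ≠ 0`, an entrywise a-priori bound `E` on
the error of the computed residual `r̂`, and `‖r̂‖ + ‖E‖ ≤ ρ‖x‖`: some `|λ↓_j(A) − μ| ≤ ρ`.
[cite: HornJohnson2013, Thm 6.3.14] -/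
theorem exists_abs_eigenvalues₀_sub_le_of_entrywise [DecidableEq n] {A : Matrix n n ℝ}
    (hA : A.IsHermitian) {x : n → ℝ} (hx : x ≠ 0) {μ ρ : ℝ} {r E : n → ℝ}
    (h : ∀ i, |r i - ((A *ᵥ x) i - μ * x i)| ≤ E i)
    (hρ : ‖(toLp 2 r : EuclideanSpace ℝ n)‖ + ‖(toLp 2 E : EuclideanSpace ℝ n)‖ ≤
      ρ * ‖(toLp 2 x : EuclideanSpace ℝ n)‖) :
    ∃ j : Fin (Fintype.card n), |hA.eigenvalues₀ j - μ| ≤ ρ :=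
  MatrixFreeLevel.exists_abs_eigenvalues₀_sub_le_of_norm_le hA hx
    ((residual_norm_le_of_entrywise A x μ h).trans hρ)

end Norm

/-! ### §5 Frobenius mass from matrix-free applications (the input `U` of the self-isolation) -/

section Frobenius

variable {m n : Type*} [Fintype m] [Fintype n]

/-- From an entrywise chain bound `|ŵ − A v| ≤ E`: `‖A v‖ ≤ ‖ŵ‖ + ‖E‖`. [folklore] -/
theorem norm_mulVec_le_of_entrywise (A : Matrix m n ℝ) (v : n → ℝ) {wc E : m → ℝ}
    (h : ∀ i, |wc i - (A *ᵥ v) i| ≤ E i) :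
    ‖(toLp 2 (A *ᵥ v) : EuclideanSpace ℝ m)‖ ≤
      ‖(toLp 2 wc : EuclideanSpace ℝ m)‖ + ‖(toLp 2 E : EuclideanSpace ℝ m)‖ :=
  norm_toLp_le_add_of_abs_sub_le h

/-- Checker shape: `Σᵢ (A v)ᵢ² ≤ (‖ŵ‖ + ‖E‖)²`. [folklore] -/
theorem sum_sq_mulVec_le_of_entrywise (A : Matrix m n ℝ) (v : n → ℝ) {wc E : m → ℝ}
    (h : ∀ i, |wc i - (A *ᵥ v) i| ≤ E i) :
    ∑ i, ((A *ᵥ v) i) ^ 2 ≤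
      (‖(toLp 2 wc : EuclideanSpace ℝ m)‖ + ‖(toLp 2 E : EuclideanSpace ℝ m)‖) ^ 2 := by
  rw [← MatrixFreeLevel.norm_sq_toLp_eq_sum]
  exact pow_le_pow_left₀ (norm_nonneg _) (norm_mulVec_le_of_entrywise A v h) 2

/-- `‖A‖_F² = Σ_l ‖A e_l‖²`: the Frobenius mass is the sum over the basis of the squared norms of the
matrix applied to the basis vectors. [cite: HornJohnson2013, §5.6 (Frobenius norm)] -/
theorem sum_sum_sq_eq_sum_mulVec_single [DecidableEq n] (A : Matrix m n ℝ) :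
    ∑ i, ∑ l, A i l ^ 2 = ∑ l, ∑ i, ((A *ᵥ Pi.single l 1) i) ^ 2 := by
  rw [Finset.sum_comm]
  refine Finset.sum_congr rfl fun l _ => Finset.sum_congr rfl fun i _ => ?_
  rw [Matrix.mulVec_single_one, Matrix.col_apply]

/-- **Frobenius mass from per-column bounds**: `Σᵢ (A e_l)ᵢ² ≤ U_l` for every basis vector ⇒
`Σᵢ Σ_l Aᵢₗ² ≤ Σ_l U_l` — the hypothesis `hU` of `FrobeniusDeflation.*`. [cite: HornJohnson2013, §5.6] -/
theorem sum_sum_sq_le_of_columns [DecidableEq n] (A : Matrix m n ℝ) {U : n → ℝ}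
    (h : ∀ l, ∑ i, ((A *ᵥ Pi.single l 1) i) ^ 2 ≤ U l) : ∑ i, ∑ l, A i l ^ 2 ≤ ∑ l, U l := by
  rw [sum_sum_sq_eq_sum_mulVec_single]
  exact Finset.sum_le_sum fun l _ => h l

/-- **Frobenius mass from matrix-free applications to the basis vectors** with their a-priori error
vectors: `|ŵ⁽ˡ⁾ − A e_l| ≤ E⁽ˡ⁾` for all `l` ⇒ `Σᵢ Σ_l Aᵢₗ² ≤ Σ_l (‖ŵ⁽ˡ⁾‖ + ‖E⁽ˡ⁾‖)²`.
[cite: HornJohnson2013, §5.6] -/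
theorem sum_sum_sq_le_of_entrywise [DecidableEq n] (A : Matrix m n ℝ) {wc E : n → m → ℝ}
    (h : ∀ l i, |wc l i - (A *ᵥ Pi.single l 1) i| ≤ E l i) :
    ∑ i, ∑ l, A i l ^ 2 ≤
      ∑ l, (‖(toLp 2 (wc l) : EuclideanSpace ℝ m)‖ + ‖(toLp 2 (E l) : EuclideanSpace ℝ m)‖) ^ 2 :=
  sum_sum_sq_le_of_columns A fun l => sum_sq_mulVec_le_of_entrywise A (Pi.single l 1) (h l)

end Frobenius

/-! ### §6 Hypothesis (R) from the standard model of floating-point arithmetic -/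

section StandardModel

open Literature.ComputerArithmetic.Higham2002

variable {m : Type*} {N : ℕ}

/-- **Rounding hypothesis of a stage from the model.**  If output entry `i` is the recursively
accumulated inner product (tree: `Higham2002.recDot`) of row `i` of the computed factor with the computed
input — `N + 1` terms, products rounded with `|ε| ≤ u`, additions with `|δ| ≤ u`, `(N+1)u < 1` — then
`|ŵ'ᵢ − (F̃ ŵ)ᵢ| ≤ γ_{N+1} (|F̃| |ŵ|)ᵢ`, i.e. hypothesis (R) of §2 with `γ = γ_{N+1} = (N+1)u/(1−(N+1)u)`.
(Row streams `fa i`, `wa` on `ℕ` agree with the row / the vector on the first `N + 1` indices.)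
[cite: Higham2002ASNA, §3.1 eq. (3.4)–(3.5)] -/
theorem abs_recDot_sub_mulVec_le (Fc : Matrix m (Fin (N + 1)) ℝ) (wc : Fin (N + 1) → ℝ)
    {u : ℝ} (hu : 0 ≤ u) (hN : ((N + 1 : ℕ) : ℝ) * u < 1) (fa ε δ : m → ℕ → ℝ) (wa : ℕ → ℝ)
    (hfa : ∀ i (k : Fin (N + 1)), fa i k = Fc i k) (hwa : ∀ k : Fin (N + 1), wa k = wc k)
    (hε : ∀ i k, |ε i k| ≤ u) (hδ : ∀ i k, |δ i k| ≤ u) {wc' : m → ℝ}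
    (hw : ∀ i, wc' i = recDot (fa i) wa (ε i) (δ i) N) (i : m) :
    |wc' i - (Fc *ᵥ wc) i| ≤ gamma u (N + 1) * (Fc.map abs *ᵥ fun j => |wc j|) i := by
  have key := abs_recDot_sub_sum_le_gamma hu hN (fa i) wa (ε i) (δ i) (hε i) (hδ i)
  have hS : ∑ k ∈ range (N + 1), fa i k * wa k = (Fc *ᵥ wc) i := by
    rw [Finset.sum_range]
    simp only [Matrix.mulVec, dotProduct]
    exact Finset.sum_congr rfl fun k _ => by rw [hfa i k, hwa k]
  have hA : ∑ k ∈ range (N + 1), |fa i k * wa k| = (Fc.map abs *ᵥ fun j => |wc j|) i := by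
    rw [Finset.sum_range]
    simp only [Matrix.mulVec, dotProduct, Matrix.map_apply]
    exact Finset.sum_congr rfl fun k _ => by rw [hfa i k, hwa k, abs_mul]
  rw [hw i, ← hS, ← hA]
  exact key

end StandardModel

end MatvecChain

end Summit.Ventures.YMGap.FlowData
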